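import Summits.ABC.StewartYu.PadicTwistSetup
import HarnessLib

/-!
# Cell abc-stewartyu, WP-Y3 (ii): the twisted set-up — exponents of the auxiliary functions and
# the values of the exponentials at the integer and half points

`Summits/ABC/StewartYu/PadicTwistValues.lean` — cell `abc-stewartyu` (seat p2; crux
`YuNinetyThreeModFour` stmt-ABC-19249, line `twist-w80`), sequel to `PadicTwistSetup.lean`.
Plain definitions and theorems; no named fact.

For the twisted set-up `S : TwistSetup p` (generators `allᵢ ∈ ℚ`, twisted principal units
`ωᵢ = allᵢ ηᵢ`, `ηᵢ^G = 1`, `G` odd for the half-point identities): the exponents `ψ_u = ∑ λⱼ log_p ωⱼ + λ_θ log_p ω_θ`,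
`expo u = ψ_u + λ_θ Λ₀ = ∑ γⱼ log_p ωⱼ` (norms `≤ p⁻¹`), and the two value identities by which the
twist meets p3's sign-free rational cores (`SetupQ.qE`, `SetupQ.classVec`):
* `exp_ψ_natCast`: `exp(s ψ_u) = (cls u)^s · qE(u,s)` [Yu 1990 (2.61)];
* `exp_ψ_half_natCast`: `exp(s ψ_u/2) = ((cls u)^s)^{(G+1)/2} · ∏ᵢ sqᵢ^{expnᵢ(u,s)}` with the square
  roots `sqᵢ := psqrt(ωᵢ) ηᵢ^{(G−1)/2} ∈ ℚ_p`, `sqᵢ² = allᵢ` [Yu 1990 (2.92)–(2.94), with `ξ := η^{(G+1)/2}`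
  inside `μ_G` because `G` is odd];
* `cls_reidx`: `cls(ε + 2λ') = cls₀(ε) · cls(λ')²` (the class update of the descent [Yu 1990 (2.104)]),
  and square roots / their uniqueness inside `μ_G`.

## References
* [Yu1990] K. Yu, *Linear forms in p-adic logarithms II*, Compositio Math. 74 (1990), §2.
* [CijsouwWaldschmidt1977] P. L. Cijsouw, M. Waldschmidt, Compositio Math. 34 (1977), §4.
-/

noncomputable section

open NormedSpace Finset IsUltrametricDist
open Literature.NumberTheory.Transcendental
open Literature.NumberTheory.Transcendental.CW77.Setup (Idx Tau tauNorm)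
open scoped Nat

namespace Summit.ABC.StewartYu

namespace TwistSetup

variable {p : ℕ} [Fact p.Prime] (S : TwistSetup p) {h Lb : ℕ}

/-! ### `p`-adic norms of the rational data -/


/-- **`‖βⱼ‖_p ≤ 1`** (`ord_p b_θ ≤ ord_p bⱼ`). [cite: Yu1990, Theorem 2.1 (2.17)] -/
theorem norm_β_le (j : Fin S.d) : ‖(S.frame.β j : ℚ_[p])‖ ≤ 1 := by
  rw [show S.frame.β j = -(S.b j : ℚ) / S.bθ from rfl]; push_cast
  rw [norm_div, norm_neg]
  by_cases hj : S.b j = 0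
  · rw [hj]; simp
  refine div_le_one_of_le₀ ?_ (norm_nonneg _)
  have h1 : ‖((S.b j : ℚ) : ℚ_[p])‖ ≤ ‖((S.bθ : ℚ) : ℚ_[p])‖ := by
    rw [Padic.norm_eq_zpow_neg_valuation (by exact_mod_cast hj), Padic.valuation_ratCast,
      Padic.norm_eq_zpow_neg_valuation (by exact_mod_cast S.bθ_ne), Padic.valuation_ratCast,
      padicValRat.of_int, padicValRat.of_int]
    exact zpow_le_zpow_right₀ S.one_lt_p.le (neg_le_neg (Int.ofNat_le.mpr (S.hbmin j hj)))
  simpa using h1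

/-- `‖γⱼ(u)‖_p ≤ 1`. [folklore] -/
theorem norm_γ_le (u : Idx S.d h Lb) (j : Fin S.d) : ‖(S.frame.γ u j : ℚ_[p])‖ ≤ 1 := by
  unfold CW77.Setup.γ; push_cast
  refine (norm_add_le_max _ _).trans (max_le ?_ ?_)
  · exact_mod_cast Padic.norm_int_le_one (p := p) (u.2.1 j : ℤ)
  · rw [norm_mul]
    refine mul_le_one₀ ?_ (norm_nonneg _) (S.norm_β_le j)
    exact_mod_cast Padic.norm_int_le_one (p := p) (u.2.2 : ℤ)

/-- `‖qA(u, τ')‖_p ≤ 1`. [folklore] -/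
theorem norm_qA_le (u : Idx S.d h Lb) (τ' : Fin S.d → ℕ) : ‖(S.frame.qA u τ' : ℚ_[p])‖ ≤ 1 := by
  unfold CW77.Setup.qA; push_cast
  rw [norm_prod]
  exact prod_le_one (fun j _ => norm_nonneg _) fun j _ => by
    rw [norm_pow]; exact pow_le_one₀ (norm_nonneg _) (S.norm_γ_le u j)

/-- **`‖qE(u, s)‖_p = 1`** (the generators are units). [folklore] -/
theorem norm_qE (u : Idx S.d h Lb) (s : ℕ) : ‖(S.toQ.qE u s : ℚ_[p])‖ = 1 := by
  rw [S.toQ.qE_eq_prod_all]; push_cast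
  rw [norm_prod]
  exact prod_eq_one fun i _ => by rw [norm_pow, S.norm_all, one_pow]


/-! ### The exponents of the auxiliary functions -/

/-- The exact exponent `ψ_u = ∑ λⱼ lg j + λ_θ lgθ` (of `φ`). [cite: CijsouwWaldschmidt1977, §4 (p. 185)] -/
def ψ (u : Idx S.d h Lb) : ℚ_[p] := ∑ j, (u.2.1 j : ℚ_[p]) * S.lg j + (u.2.2 : ℚ_[p]) * S.lgθ

/-- The perturbed exponent `expo u = ψ_u + λ_θ Λ₀` (of `f`). [cite: CijsouwWaldschmidt1977, §4 (p. 184)] -/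
def expo (u : Idx S.d h Lb) : ℚ_[p] := S.ψ u + (u.2.2 : ℚ_[p]) * S.Λ₀

/-- **The identity behind `f`**: `expo u = ∑ⱼ γⱼ(u) lg j`. [cite: CijsouwWaldschmidt1977, §4 (p. 184)] -/
theorem expo_eq (u : Idx S.d h Lb) :
    S.expo u = ∑ j : Fin S.d, (S.frame.γ u j : ℚ_[p]) * S.lg j := by
  unfold expo ψ Λ₀ CW77.Setup.γ
  push_cast
  simp only [add_mul, sum_add_distrib, mul_sum, mul_sub]
  ring

/-- `‖ψ_u‖ ≤ p⁻¹`. [cite: Yu1990, §1.1] -/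
theorem norm_ψ_le (u : Idx S.d h Lb) : ‖S.ψ u‖ ≤ (p : ℝ)⁻¹ := by
  unfold ψ
  refine (norm_add_le_max _ _).trans (max_le ?_ ?_)
  · refine IsUltrametricDist.norm_sum_le_of_forall_le_of_nonneg (by positivity) fun j _ => ?_
    rw [norm_mul]
    refine (mul_le_of_le_one_left (norm_nonneg _) ?_).trans (S.norm_lg_le j)
    exact_mod_cast Padic.norm_int_le_one (p := p) (u.2.1 j : ℤ)
  · rw [norm_mul]
    refine (mul_le_of_le_one_left (norm_nonneg _) ?_).trans S.norm_lgθ_le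
    exact_mod_cast Padic.norm_int_le_one (p := p) (u.2.2 : ℤ)

/-- `‖expo u‖ ≤ p⁻¹`. [cite: Yu1990, §1.1] -/
theorem norm_expo_le (u : Idx S.d h Lb) : ‖S.expo u‖ ≤ (p : ℝ)⁻¹ := by
  rw [S.expo_eq]
  refine IsUltrametricDist.norm_sum_le_of_forall_le_of_nonneg (by positivity) fun j _ => ?_
  rw [norm_mul]
  exact (mul_le_of_le_one_left (norm_nonneg _) (S.norm_γ_le u j)).trans (S.norm_lg_le j)

/-- `‖λ_θ Λ₀‖ ≤ ‖Λ₀‖`. [folklore] -/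
theorem norm_natCast_mul_Λ₀_le (n : ℕ) : ‖(n : ℚ_[p]) * S.Λ₀‖ ≤ ‖S.Λ₀‖ := by
  rw [norm_mul]
  refine mul_le_of_le_one_left (norm_nonneg _) ?_
  exact_mod_cast Padic.norm_int_le_one (p := p) (n : ℤ)

/-- `ψ_u · s = ∑ᵢ expnᵢ(u,s) · log_p ωᵢ`. [folklore] -/
theorem ψ_mul_natCast (u : Idx S.d h Lb) (s : ℕ) :
    S.ψ u * (s : ℚ_[p]) = ∑ i : Fin (S.d + 1), (S.frame.expn u s i : ℚ_[p]) * S.lgAll i := by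
  unfold ψ lg lgθ
  rw [Fin.sum_univ_castSucc]
  simp only [S.frame_expn_castSucc, S.frame_expn_last]
  push_cast
  rw [add_mul, sum_mul]
  congr 1
  · exact sum_congr rfl fun j _ => by ring
  · ring

/-- **`exp (s ψ_u) = (cls u)ˢ · qE(u, s)`** at a natural number `s`: the twist shows as the class
value. [cite: Yu1990, §2.3 (2.61)] -/
theorem exp_ψ_natCast (u : Idx S.d h Lb) (s : ℕ) :
    exp (S.ψ u * (s : ℚ_[p])) = S.cls u ^ s * (S.toQ.qE u s : ℚ_[p]) := by
  rw [S.ψ_mul_natCast, PadicExp.exp_sum_of_norm_le S.hp3 univ _ fun i _ => ?_]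
  · rw [S.toQ.qE_eq_prod_all, S.cls_pow]; push_cast
    rw [← prod_mul_distrib]
    refine prod_congr rfl fun i _ => ?_
    rw [S.exp_natCast_mul_lgAll i]
    unfold ω; rw [mul_pow, mul_comm]
  · rw [norm_mul]
    refine (mul_le_of_le_one_left (norm_nonneg _) ?_).trans (S.norm_lgAll_le i)
    exact_mod_cast Padic.norm_int_le_one (p := p) (S.frame.expn u s i : ℤ)

/-- **On a class the value at `s` is `ρˢ · qE(u,s)`.** [cite: Yu1990, §2.3 (2.61)] -/
theorem exp_ψ_natCast_of_cls {u : Idx S.d h Lb} {ρ : ℚ_[p]} (hu : S.cls u = ρ) (s : ℕ) :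
    exp (S.ψ u * (s : ℚ_[p])) = ρ ^ s * (S.toQ.qE u s : ℚ_[p]) := by
  rw [S.exp_ψ_natCast, hu]

/-! ### The square roots and the values at the half points -/

/-- **The square root `sqᵢ := psqrt(ωᵢ) · ηᵢ^{(G−1)/2} ∈ ℚ_p` of the RATIONAL generator `allᵢ`.**
[cite: Yu1990, §2 (2.25)] -/
def sq (i : Fin (S.d + 1)) : ℚ_[p] := PadicExp.psqrt (S.ω i) * S.η i ^ ((S.G - 1) / 2)

/-- **`sqᵢ · sqᵢ = allᵢ`** (`psqrt(ω)² = ω = all·η` and `(η^{(G−1)/2})² · η = η^G = 1`).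
[cite: Yu1990, §2 (2.25)] -/
theorem sq_mul_self (hodd : Odd S.G) (i : Fin (S.d + 1)) : S.sq i * S.sq i = ((S.toQ.all i : ℚ) : ℚ_[p]) := by
  unfold sq
  have h1 : PadicExp.psqrt (S.ω i) * PadicExp.psqrt (S.ω i) = S.ω i :=
    PadicExp.psqrt_mul_self S.hp3 (S.norm_one_sub_ω_le i)
  have h2 : S.η i ^ ((S.G - 1) / 2) * S.η i ^ ((S.G - 1) / 2) * S.η i = 1 := by
    rw [← pow_add, ← two_mul, ← pow_succ, (S.two_mul_half_add_one hodd).1, S.hηG]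
  calc PadicExp.psqrt (S.ω i) * S.η i ^ ((S.G - 1) / 2) * (PadicExp.psqrt (S.ω i) * S.η i ^ ((S.G - 1) / 2))
      = (PadicExp.psqrt (S.ω i) * PadicExp.psqrt (S.ω i)) *
          (S.η i ^ ((S.G - 1) / 2) * S.η i ^ ((S.G - 1) / 2)) := by ring
    _ = (S.toQ.all i : ℚ_[p]) * (S.η i ^ ((S.G - 1) / 2) * S.η i ^ ((S.G - 1) / 2) * S.η i) := by
        rw [h1]; unfold ω; ring
    _ = (S.toQ.all i : ℚ_[p]) := by rw [h2, mul_one]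

/-- `‖sqᵢ‖ = 1`. [folklore] -/
theorem norm_sq (i : Fin (S.d + 1)) : ‖S.sq i‖ = 1 := by
  unfold sq
  rw [norm_mul, norm_pow, S.norm_η, one_pow, mul_one,
    PadicExp.norm_psqrt S.hp3 (S.norm_one_sub_ω_le i)]

/-- `‖sqᵢ‖ ≤ 1`. [folklore] -/
theorem norm_sq_le (i : Fin (S.d + 1)) : ‖S.sq i‖ ≤ 1 := (S.norm_sq i).le

/-- `psqrt(ωᵢ) = sqᵢ · ηᵢ^{(G+1)/2}` (`η^{(G−1)/2} · η^{(G+1)/2} = η^G = 1`). [folklore] -/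
theorem psqrt_ω_eq (hodd : Odd S.G) (i : Fin (S.d + 1)) :
    PadicExp.psqrt (S.ω i) = S.sq i * S.η i ^ ((S.G + 1) / 2) := by
  unfold sq
  rw [mul_assoc, ← pow_add, add_comm, (S.two_mul_half_add_one hodd).2, S.hηG, mul_one]

/-- **`exp (s ψ_u / 2) = ((cls u)ˢ)^{(G+1)/2} · ∏ᵢ sqᵢ^{expnᵢ(u,s)}`**: the value at the half point
`s/2` lies on the square roots `sqᵢ ∈ ℚ_p` of the rational generators, up to a power of the class
value. [cite: Yu1990, §2.4 (2.92)–(2.94)] -/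
theorem exp_ψ_half_natCast (hodd : Odd S.G) (u : Idx S.d h Lb) (s : ℕ) :
    exp (S.ψ u * ((2 : ℚ_[p])⁻¹ * (s : ℚ_[p]))) =
      (S.cls u ^ s) ^ ((S.G + 1) / 2) * ∏ i : Fin (S.d + 1), S.sq i ^ S.frame.expn u s i := by
  have e : S.ψ u * ((2 : ℚ_[p])⁻¹ * (s : ℚ_[p])) =
      ∑ i : Fin (S.d + 1), (S.frame.expn u s i : ℚ_[p]) * ((2 : ℚ_[p])⁻¹ * S.lgAll i) := by
    rw [show S.ψ u * ((2 : ℚ_[p])⁻¹ * (s : ℚ_[p])) = (2 : ℚ_[p])⁻¹ * (S.ψ u * s) by ring,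
      S.ψ_mul_natCast, mul_sum]
    exact sum_congr rfl fun i _ => by ring
  rw [e, PadicExp.exp_sum_of_norm_le S.hp3 univ _ fun i _ => ?_]
  · have hterm : ∀ i : Fin (S.d + 1),
        exp ((S.frame.expn u s i : ℚ_[p]) * ((2 : ℚ_[p])⁻¹ * S.lgAll i)) =
          S.sq i ^ S.frame.expn u s i * (S.η i ^ S.frame.expn u s i) ^ ((S.G + 1) / 2) := by
      intro i
      unfold lgAll
      rw [PadicExp.exp_natCast_mul_half_plog S.hp3 (S.norm_one_sub_ω_le i), S.psqrt_ω_eq hodd, mul_pow,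
        ← pow_mul, ← pow_mul, mul_comm ((S.G + 1) / 2)]
    simp_rw [hterm]
    rw [prod_mul_distrib, S.cls_pow, ← prod_pow, mul_comm]
  · rw [norm_mul]
    refine (mul_le_of_le_one_left (norm_nonneg _) ?_).trans ?_
    · exact_mod_cast Padic.norm_int_le_one (p := p) (S.frame.expn u s i : ℤ)
    · unfold lgAll
      rw [PadicExp.norm_inv_two_mul_plog S.hp3 (S.norm_one_sub_ω_le i)]
      exact S.norm_one_sub_ω_le i

/-- **On a class the value at `s/2` is `(ρˢ)^{(G+1)/2} · ∏ᵢ sqᵢ^{expnᵢ(u,s)}`.** [cite: Yu1990, §2.4 (2.93)] -/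
theorem exp_ψ_half_natCast_of_cls (hodd : Odd S.G) {u : Idx S.d h Lb} {ρ : ℚ_[p]} (hu : S.cls u = ρ) (s : ℕ) :
    exp (S.ψ u * ((2 : ℚ_[p])⁻¹ * (s : ℚ_[p]))) =
      (ρ ^ s) ^ ((S.G + 1) / 2) * ∏ i : Fin (S.d + 1), S.sq i ^ S.frame.expn u s i := by
  rw [S.exp_ψ_half_natCast hodd, hu]

/-! ### The class value under the re-indexing `λ = ε + 2λ'` of the descent -/

/-- **`cls (reidx ε ε_θ v) = cls₀(ε) · (cls v)²`** where `cls₀(ε) = ∏ᵢ ηᵢ^{resVecᵢ(ε)}`: the class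
value of `ε + 2λ'`. [cite: Yu1990, §2.4 (2.101)–(2.104)] -/
theorem cls_reidx (ε : Fin S.d → ℕ) (εθ : ℕ) (v : Idx S.d h Lb) :
    S.cls (S.frame.reidx ε εθ v) = (∏ i, S.η i ^ S.frame.resVec ε εθ i) * S.cls v ^ 2 := by
  unfold cls
  rw [Fin.prod_univ_castSucc, Fin.prod_univ_castSucc, Fin.prod_univ_castSucc]
  simp only [S.expn_one_castSucc, S.expn_one_last, S.frame_resVec_castSucc, S.frame_resVec_last,
    S.frame_reidx_snd_fst, S.frame_reidx_snd_snd]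
  simp only [pow_add, pow_mul', prod_mul_distrib, prod_pow]
  ring

/-- **Square roots inside `μ_G`**: `(x^{(G+1)/2})² = x` for `x^G = 1` (`G` odd). [folklore] -/
theorem pow_half_succ_sq (hodd : Odd S.G) {x : ℚ_[p]} (hx : x ^ S.G = 1) : (x ^ ((S.G + 1) / 2)) ^ 2 = x := by
  rw [← pow_mul, show (S.G + 1) / 2 * 2 = S.G + 1 by obtain ⟨k, hk⟩ := hodd; omega,
    pow_succ, hx, one_mul]

/-- Uniqueness of square roots inside `μ_G` (`G` odd): `x² = y²`, `x^G = y^G = 1` ⇒ `x = y`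
(`x = (x²)^{(G+1)/2} · (x^G)^{-1}`…: directly, `x = x^{G+1}/x^G = (x²)^{(G+1)/2}`). [folklore] -/
theorem eq_of_sq_eq_of_pow_G (hodd : Odd S.G) {x y : ℚ_[p]} (hx : x ^ S.G = 1) (hy : y ^ S.G = 1)
    (h : x ^ 2 = y ^ 2) : x = y := by
  have kx : x = (x ^ 2) ^ ((S.G + 1) / 2) := by
    rw [← pow_mul, S.two_mul_half_succ hodd, pow_succ, hx, one_mul]
  have ky : y = (y ^ 2) ^ ((S.G + 1) / 2) := by
    rw [← pow_mul, S.two_mul_half_succ hodd, pow_succ, hy, one_mul]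
  rw [kx, ky, h]

end TwistSetup

end Summit.ABC.StewartYu

end
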